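import Summits.RiemannHypothesis.RiemannHypothesis.Theses.WeilComb
import Summits.RiemannHypothesis.RiemannHypothesis.Theorems.WeilCombCombShapeAdmissible
import Summits.RiemannHypothesis.RiemannHypothesis.Theorems.WeilCombCombShapePositivityArchOffdiag
import Literature.NumberTheory.LFunctions.WeilExplicit
import Literature.NumberTheory.LFunctions.WeilMellinBounds
import Literature.NumberTheory.LFunctions.WeilArchimedeanPositivityProofs

/-!
# Sub-goal `weilArchTerm_translate_psi_offdiag_bounds` of stub `stub_window` (line `Sketch`) for
crux `WeilComb.CombShapePositivity` (item stmt-RiemannHypothesis-11229, route route-RiemannHypothesis-WeilComb)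

Sign and size of the archimedean kernel of the fixed-shape comb OFF THE DIAGONAL.
Notation: `φ₀(u) = expNegInvGlue (1 - u²)` (the route's fixed bump), `φ_ε(t) = ε⁻¹ φ₀(t/ε)`,
`ψ_ε = φ_ε ⋆ φ̃_ε` (`weilConv` / `weilReflect`), `τ_x h = weilTranslate h x = h(· − x)`,
`W_∞ = weilArchTerm`, `g(t) = e^{t/2} / (2 sinh t)`, `I₀ = ∫ φ₀`.

**Statement.** For `ε > 0` and `x > 2ε`, `W_∞(τ_x ψ_ε)` is real and
`−I₀² g(x − 2ε) ≤ W_∞(τ_x ψ_ε) ≤ −I₀² g(x + 2ε)`.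

**Proof.** By the landed Bombieri form (`weilArchTerm_translate_psi_offdiag`),
`W_∞(τ_x ψ_ε) = −∫₀^∞ g(t) (ψ_ε(t − x) + ψ_ε(−t − x)) dt`. Write `φ_ε = ↑f` with the real profile
`f = ε⁻¹ φ₀(·/ε) ≥ 0`, `supp f ⊆ [−ε, ε]`; then `ψ_ε = ↑P` with the real autocorrelation
`P = f ⋆ f(−·) ≥ 0`, `P(s) = 0` for `|s| > 2ε`, and `∫ P = (∫ f)² = I₀²`
(`MeasureTheory.integral_convolution` and the dilation `t = εu`). For `t > 0` the reflected term
`P(−t − x)` vanishes, `P(t − x)` vanishes unless `t ∈ [x − 2ε, x + 2ε] ⊂ (0, ∞)`, and on `(0, ∞)`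
the weight `g(t) = 1/(e^{t/2} − e^{−3t/2})` is decreasing, so
`I₀² g(x + 2ε) ≤ ∫₀^∞ g(t) P(t − x) dt ≤ I₀² g(x − 2ε)`; finally `W_∞(τ_x ψ_ε) = −∫₀^∞ g(t) P(t − x) dt`.
-/

noncomputable section

-- the sub-problem path RiemannHypothesis/RiemannHypothesis duplicates a namespace (D-0017)
set_option linter.dupNamespace false

open scoped BigOperators ComplexConjugate Convolution
open Complex MeasureTheory Set

namespace Summit.RiemannHypothesis.RiemannHypothesis.Theorems.WeilCombBohrFejer

open Literature.NumberTheory.LFunctions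

/-! ### The weight `g(t) = e^{t/2} / (2 sinh t)` -/

/-- `e^{t/2} / (2 sinh t) = 1 / (e^{t/2} − e^{−3t/2})` (both sides vanish at `t = 0`). [folklore] -/
private theorem archWeight_eq (t : ℝ) :
    Real.exp (t / 2) / (2 * Real.sinh t) = 1 / (Real.exp (t / 2) - Real.exp (-(3 * t / 2))) := by
  have h : 2 * Real.sinh t = Real.exp (t / 2) * (Real.exp (t / 2) - Real.exp (-(3 * t / 2))) := by
    rw [mul_sub, ← Real.exp_add, ← Real.exp_add, Real.sinh_eq]
    have e1 : t / 2 + t / 2 = t := by ring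
    have e2 : t / 2 + -(3 * t / 2) = -t := by ring
    rw [e1, e2]
    ring
  rw [h, div_mul_eq_div_div, div_self (Real.exp_pos _).ne']

/-- The weight is positive on `(0, ∞)`. [folklore] -/
private theorem archWeight_pos {t : ℝ} (ht : 0 < t) : 0 < Real.exp (t / 2) / (2 * Real.sinh t) :=
  div_pos (Real.exp_pos _) (mul_pos two_pos (Real.sinh_pos_iff.2 ht))

/-- The weight `g(t) = e^{t/2} / (2 sinh t)` is decreasing on `(0, ∞)`: its reciprocal
`e^{t/2} − e^{−3t/2}` is increasing. [folklore] -/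
private theorem archWeight_antitone {a b : ℝ} (ha : 0 < a) (hab : a ≤ b) :
    Real.exp (b / 2) / (2 * Real.sinh b) ≤ Real.exp (a / 2) / (2 * Real.sinh a) := by
  rw [archWeight_eq, archWeight_eq]
  have hDa : 0 < Real.exp (a / 2) - Real.exp (-(3 * a / 2)) :=
    sub_pos.2 (Real.exp_lt_exp.2 (by linarith))
  refine one_div_le_one_div_of_le hDa ?_
  have h1 : Real.exp (a / 2) ≤ Real.exp (b / 2) := Real.exp_le_exp.2 (by linarith)
  have h2 : Real.exp (-(3 * b / 2)) ≤ Real.exp (-(3 * a / 2)) := Real.exp_le_exp.2 (by linarith)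
  linarith

/-! ### The real autocorrelation `P = f ⋆ f(−·)` of a real profile -/

/-- For a real profile `φ = ↑f`: `φ ⋆ φ̃ = ↑(f ⋆ f(−·))` pointwise. [folklore] -/
private theorem weilConv_weilReflect_ofReal (f : ℝ → ℝ) (s : ℝ) :
    weilConv (fun t : ℝ => ((f t : ℝ) : ℂ)) (weilReflect fun t : ℝ => ((f t : ℝ) : ℂ)) s =
      (((f ⋆[ContinuousLinearMap.mul ℝ ℝ, volume] (fun v => f (-v))) s : ℝ) : ℂ) := by
  rw [weilConv_apply, convolution_def, ← integral_complex_ofReal]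
  congr 1 with u
  simp only [weilReflect, Complex.conj_ofReal, ContinuousLinearMap.mul_apply', Complex.ofReal_mul]

/-- The autocorrelation of `f ≥ 0` is `≥ 0`. [folklore] -/
private theorem autocorr_nonneg {f : ℝ → ℝ} (hf0 : ∀ t, 0 ≤ f t) (s : ℝ) :
    0 ≤ (f ⋆[ContinuousLinearMap.mul ℝ ℝ, volume] (fun v => f (-v))) s := by
  rw [convolution_def]
  exact integral_nonneg fun u => by
    simp only [Pi.zero_apply, ContinuousLinearMap.mul_apply']
    exact mul_nonneg (hf0 _) (hf0 _)

/-- If `supp f ⊆ [−ε, ε]` then `(f ⋆ f(−·))(s) = 0` for `|s| > 2ε`. [folklore] -/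
private theorem autocorr_eq_zero {f : ℝ → ℝ} {ε s : ℝ} (hsupp : Function.support f ⊆ Icc (-ε) ε)
    (hs : 2 * ε < |s|) : (f ⋆[ContinuousLinearMap.mul ℝ ℝ, volume] (fun v => f (-v))) s = 0 := by
  rw [convolution_def]
  refine integral_eq_zero_of_ae (Filter.Eventually.of_forall fun u => ?_)
  simp only [ContinuousLinearMap.mul_apply', Pi.zero_apply]
  by_cases hu : f u = 0
  · rw [hu, zero_mul]
  · have hu' : u ∈ Icc (-ε) ε := hsupp hu
    have hv : f (-(s - u)) = 0 := by
      by_contra hv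
      have hv' : -(s - u) ∈ Icc (-ε) ε := hsupp hv
      rw [mem_Icc] at hu' hv'
      have : |s| ≤ 2 * ε := abs_le.2 ⟨by linarith, by linarith⟩
      linarith
    rw [hv, mul_zero]

/-- `∫ (f ⋆ f(−·)) = (∫ f)²` for integrable `f` (`MeasureTheory.integral_convolution`). [folklore] -/
private theorem integral_autocorr {f : ℝ → ℝ} (hfi : Integrable f) :
    ∫ s, (f ⋆[ContinuousLinearMap.mul ℝ ℝ, volume] (fun v => f (-v))) s = (∫ u, f u) ^ 2 := by
  rw [integral_convolution (L := ContinuousLinearMap.mul ℝ ℝ) hfi hfi.comp_neg,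
    ContinuousLinearMap.mul_apply', integral_neg_eq_self f volume, sq]

/-! ### Bombieri's integrand in real form and the sandwich -/

/-- If `ψ = ↑P` with `P(s) = 0` for `|s| > 2ε` and `x > max(0, 2ε)`, Bombieri's integral for `τ_x ψ`
is the real `∫₀^∞ g(t) P(t − x) dt` (the reflected term `P(−t − x)` vanishes on `(0, ∞)`). [folklore] -/
private theorem archOffdiag_setIntegral_ofReal {ψ : ℝ → ℂ} {P : ℝ → ℝ} {ε x : ℝ} (hx0 : 0 < x)
    (hx : 2 * ε < x) (hψ : ∀ s, ψ s = P s) (hPz : ∀ s, 2 * ε < |s| → P s = 0) :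
    ∫ t in Ioi (0 : ℝ), (Real.exp (t / 2) : ℂ) * (weilTranslate ψ x t + weilTranslate ψ x (-t)) /
        (2 * Real.sinh t : ℂ) =
      ((∫ t in Ioi (0 : ℝ), Real.exp (t / 2) / (2 * Real.sinh t) * P (t - x) : ℝ) : ℂ) := by
  rw [← integral_complex_ofReal]
  refine setIntegral_congr_fun measurableSet_Ioi fun t ht => ?_
  have ht' : 0 < t := ht
  have h0 : P (-t - x) = 0 := hPz _ (by rw [abs_of_neg (by linarith)]; linarith)
  simp only [weilTranslate, hψ, h0]
  push_cast
  ring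

/-- Sandwich: for `P ≥ 0` integrable with `P(s) = 0` for `|s| > 2ε` and `x > max(0, 2ε)`,
`(∫ P) g(x + 2ε) ≤ ∫₀^∞ g(t) P(t − x) dt ≤ (∫ P) g(x − 2ε)` (`P(t − x)` lives on
`[x − 2ε, x + 2ε] ⊂ (0, ∞)`, where `g` is decreasing). [folklore] -/
private theorem archOffdiag_sandwich {P : ℝ → ℝ} {ε x : ℝ} (hx0 : 0 < x) (hx : 2 * ε < x)
    (hPi : Integrable P) (hP0 : ∀ s, 0 ≤ P s) (hPz : ∀ s, 2 * ε < |s| → P s = 0) :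
    (∫ s, P s) * (Real.exp ((x + 2 * ε) / 2) / (2 * Real.sinh (x + 2 * ε))) ≤
        ∫ t in Ioi (0 : ℝ), Real.exp (t / 2) / (2 * Real.sinh t) * P (t - x) ∧
      ∫ t in Ioi (0 : ℝ), Real.exp (t / 2) / (2 * Real.sinh t) * P (t - x) ≤
        (∫ s, P s) * (Real.exp ((x - 2 * ε) / 2) / (2 * Real.sinh (x - 2 * ε))) := by
  have hPxi : Integrable fun t => P (t - x) := hPi.comp_sub_right x
  -- `∫₀^∞ P(t - x) dt = ∫ P`
  have hIoi : ∫ t in Ioi (0 : ℝ), P (t - x) = ∫ s, P s := by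
    rw [setIntegral_eq_integral_of_forall_compl_eq_zero, integral_sub_right_eq_self _ x]
    intro t ht
    rw [mem_Ioi, not_lt] at ht
    exact hPz _ (by rw [abs_of_neg (by linarith)]; linarith)
  -- the window carrying `P(· - x)`
  have hwin : ∀ t, P (t - x) ≠ 0 → x - 2 * ε ≤ t ∧ t ≤ x + 2 * ε := by
    intro t ht
    have h : |t - x| ≤ 2 * ε := not_lt.1 fun h => ht (hPz _ h)
    constructor <;> linarith [(abs_le.1 h).1, (abs_le.1 h).2]
  have hup : ∀ t ∈ Ioi (0 : ℝ), Real.exp (t / 2) / (2 * Real.sinh t) * P (t - x) ≤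
      Real.exp ((x - 2 * ε) / 2) / (2 * Real.sinh (x - 2 * ε)) * P (t - x) := by
    intro t _ht
    by_cases hPt : P (t - x) = 0
    · rw [hPt, mul_zero, mul_zero]
    · exact mul_le_mul_of_nonneg_right
        (archWeight_antitone (by linarith) (hwin t hPt).1) (hP0 _)
  have hlo : ∀ t ∈ Ioi (0 : ℝ), Real.exp ((x + 2 * ε) / 2) / (2 * Real.sinh (x + 2 * ε)) * P (t - x) ≤
      Real.exp (t / 2) / (2 * Real.sinh t) * P (t - x) := by
    intro t ht
    by_cases hPt : P (t - x) = 0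
    · rw [hPt, mul_zero, mul_zero]
    · exact mul_le_mul_of_nonneg_right (archWeight_antitone ht (hwin t hPt).2) (hP0 _)
  -- integrability of `g(t) P(t - x)` on `(0, ∞)` (dominated by `g(x - 2ε) P(t - x)`)
  have hgm : Measurable fun t : ℝ => Real.exp (t / 2) / (2 * Real.sinh t) := by fun_prop
  have hJi : IntegrableOn (fun t => Real.exp (t / 2) / (2 * Real.sinh t) * P (t - x)) (Ioi 0) := by
    refine Integrable.mono'
      ((hPxi.const_mul (Real.exp ((x - 2 * ε) / 2) / (2 * Real.sinh (x - 2 * ε)))).integrableOn)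
      (hgm.aestronglyMeasurable.mul hPxi.aestronglyMeasurable).restrict
      ((ae_restrict_iff' measurableSet_Ioi).2 (Filter.Eventually.of_forall fun t ht => ?_))
    rw [Real.norm_of_nonneg (mul_nonneg (archWeight_pos ht).le (hP0 _))]
    exact hup t ht
  constructor
  · calc (∫ s, P s) * (Real.exp ((x + 2 * ε) / 2) / (2 * Real.sinh (x + 2 * ε)))
        = ∫ t in Ioi (0 : ℝ),
            Real.exp ((x + 2 * ε) / 2) / (2 * Real.sinh (x + 2 * ε)) * P (t - x) := by
          rw [integral_const_mul, hIoi, mul_comm]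
      _ ≤ ∫ t in Ioi (0 : ℝ), Real.exp (t / 2) / (2 * Real.sinh t) * P (t - x) :=
          setIntegral_mono_on (hPxi.const_mul _).integrableOn hJi measurableSet_Ioi hlo
  · calc ∫ t in Ioi (0 : ℝ), Real.exp (t / 2) / (2 * Real.sinh t) * P (t - x)
        ≤ ∫ t in Ioi (0 : ℝ),
            Real.exp ((x - 2 * ε) / 2) / (2 * Real.sinh (x - 2 * ε)) * P (t - x) :=
          setIntegral_mono_on hJi (hPxi.const_mul _).integrableOn measurableSet_Ioi hup
      _ = (∫ s, P s) * (Real.exp ((x - 2 * ε) / 2) / (2 * Real.sinh (x - 2 * ε))) := by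
          rw [integral_const_mul, hIoi, mul_comm]

/-! ### The sub-goal -/

/-- **Sub-goal (i) of `stub_window`: signed two-sided bounds for the off-diagonal archimedean
entries.** For `ε > 0` and `x > 2ε`, `W_∞(τ_x ψ_ε)` is real and
`−I₀² e^{(x−2ε)/2}/(2 sinh(x−2ε)) ≤ Re W_∞(τ_x ψ_ε) ≤ −I₀² e^{(x+2ε)/2}/(2 sinh(x+2ε))`,
`I₀ = ∫ φ₀`: Bombieri's kernel (`weilArchTerm_translate_psi_offdiag`) integrated against the
non-negative autocorrelation `ψ_ε(· − x)` of mass `I₀²` living on `[x − 2ε, x + 2ε]`, where the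
weight `e^{t/2}/(2 sinh t)` is decreasing. [folklore] -/
theorem weilArchTerm_translate_psi_offdiag_bounds : ∀ ε : ℝ, 0 < ε → ∀ x : ℝ, 2 * ε < x →
    (weilArchTerm (weilTranslate
        (weilConv (fun t : ℝ => (ε : ℂ)⁻¹ * ((expNegInvGlue (1 - (t / ε) ^ 2) : ℝ) : ℂ))
          (weilReflect (fun t : ℝ => (ε : ℂ)⁻¹ * ((expNegInvGlue (1 - (t / ε) ^ 2) : ℝ) : ℂ)))) x)).im = 0 ∧
    -((∫ u : ℝ, expNegInvGlue (1 - u ^ 2)) ^ 2 *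
        (Real.exp ((x - 2 * ε) / 2) / (2 * Real.sinh (x - 2 * ε)))) ≤
      (weilArchTerm (weilTranslate
        (weilConv (fun t : ℝ => (ε : ℂ)⁻¹ * ((expNegInvGlue (1 - (t / ε) ^ 2) : ℝ) : ℂ))
          (weilReflect (fun t : ℝ => (ε : ℂ)⁻¹ * ((expNegInvGlue (1 - (t / ε) ^ 2) : ℝ) : ℂ)))) x)).re ∧
    (weilArchTerm (weilTranslate
        (weilConv (fun t : ℝ => (ε : ℂ)⁻¹ * ((expNegInvGlue (1 - (t / ε) ^ 2) : ℝ) : ℂ))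
          (weilReflect (fun t : ℝ => (ε : ℂ)⁻¹ * ((expNegInvGlue (1 - (t / ε) ^ 2) : ℝ) : ℂ)))) x)).re ≤
      -((∫ u : ℝ, expNegInvGlue (1 - u ^ 2)) ^ 2 *
        (Real.exp ((x + 2 * ε) / 2) / (2 * Real.sinh (x + 2 * ε)))) := by
  intro ε hε x hx
  have hx0 : 0 < x := lt_trans (by positivity) hx
  have hB := weilArchTerm_translate_psi_offdiag ε hε x (by rwa [abs_of_pos hx0])
  -- the real profile `f = ε⁻¹ φ₀(·/ε)` of `φ_ε = ↑f`
  set f : ℝ → ℝ := fun t => ε⁻¹ * expNegInvGlue (1 - (t / ε) ^ 2) with hf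
  have hφ : (fun t : ℝ => (ε : ℂ)⁻¹ * ((expNegInvGlue (1 - (t / ε) ^ 2) : ℝ) : ℂ)) =
      fun t : ℝ => ((f t : ℝ) : ℂ) := by
    funext t
    simp only [hf, Complex.ofReal_mul, Complex.ofReal_inv]
  rw [hφ] at hB ⊢
  have hf0 : ∀ t, 0 ≤ f t := fun t => mul_nonneg (inv_nonneg.2 hε.le) (expNegInvGlue.nonneg _)
  have hsupp : Function.support f ⊆ Icc (-ε) ε := by
    refine Function.support_subset_iff'.2 fun t ht => ?_
    have h1 : 1 - (t / ε) ^ 2 ≤ 0 := by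
      rw [mem_Icc, not_and_or, not_le, not_le] at ht
      rcases ht with h | h
      · have h' : t / ε < -1 := by rw [div_lt_iff₀ hε]; linarith
        nlinarith
      · have h' : 1 < t / ε := by rw [lt_div_iff₀ hε]; linarith
        nlinarith
    show ε⁻¹ * expNegInvGlue (1 - (t / ε) ^ 2) = 0
    rw [expNegInvGlue.zero_of_nonpos h1, mul_zero]
  have hfc : Continuous f := by
    rw [hf]
    exact continuous_const.mul ((expNegInvGlue.contDiff (n := 0)).continuous.comp
      (by fun_prop : Continuous fun t : ℝ => 1 - (t / ε) ^ 2))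
  have hfi : Integrable f :=
    hfc.integrable_of_hasCompactSupport
      (HasCompactSupport.of_support_subset_isCompact isCompact_Icc hsupp)
  -- `∫ f = ∫ φ₀ = I₀` (dilation `t = ε u`)
  have hI : ∫ u, f u = ∫ u, expNegInvGlue (1 - u ^ 2) := by
    simp only [hf]
    rw [integral_const_mul, Measure.integral_comp_div (fun u => expNegInvGlue (1 - u ^ 2)) ε,
      abs_of_pos hε, smul_eq_mul, ← mul_assoc, inv_mul_cancel₀ hε.ne', one_mul]
  -- the real autocorrelation `P = f ⋆ f(−·)`: `ψ_ε = ↑P`, `P ≥ 0`, `supp P ⊆ [-2ε, 2ε]`, `∫ P = I₀²`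
  have hPz : ∀ s, 2 * ε < |s| →
      (f ⋆[ContinuousLinearMap.mul ℝ ℝ, volume] (fun v => f (-v))) s = 0 :=
    fun s hs => autocorr_eq_zero hsupp hs
  have hPi : Integrable (f ⋆[ContinuousLinearMap.mul ℝ ℝ, volume] (fun v => f (-v))) :=
    hfi.integrable_convolution _ hfi.comp_neg
  rw [hB, archOffdiag_setIntegral_ofReal hx0 hx (weilConv_weilReflect_ofReal f) hPz]
  obtain ⟨h1, h2⟩ := archOffdiag_sandwich hx0 hx hPi (autocorr_nonneg hf0) hPz
  rw [integral_autocorr hfi, hI] at h1 h2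
  refine ⟨by simp, ?_, ?_⟩
  · rw [Complex.neg_re, Complex.ofReal_re]
    linarith
  · rw [Complex.neg_re, Complex.ofReal_re]
    linarith

end Summit.RiemannHypothesis.RiemannHypothesis.Theorems.WeilCombBohrFejer

end
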